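import Summits.BirchSwinnertonDyer.BirchSwinnertonDyer.Theorems.PrintX11aLowerHalfThreeRamMember
import Summits.BirchSwinnertonDyer.BirchSwinnertonDyer.Theorems.KimAtThreeDeepLowerOffStratumLevelLoweringMultiStabDepleteRowsClass
import Summits.BirchSwinnertonDyer.BirchSwinnertonDyer.Theorems.KimAtThreeDeepLowerOffStratumLevelLoweringMultiStabRowsRamClass
import Literature.NumberTheory.EllipticCurves.LevelLoweringGamma0AtThreeAdditiveDrop
import Literature.NumberTheory.EllipticCurves.HidaFamilyMembersMultiplicativeProofs
import HarnessLib

/-!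
# Crux `X11aLowerHalf` (item stmt-BirchSwinnertonDyer-19064), `p = 3`: the «ram member» of `H(E[3])` CONSTRUCTED
# from an additive place of Kodaira type `IV`/`IV*` (level lowering at `3` with the additive exponent drop —
# Darmon–Diamond–Taylor Thm. 3.15 — then the Deligne–Serre weight-six lift and `3`-stabilisation backwards), so
# that the lower half at an X11a pair at `3` on the «Kodaira sub-locus» follows from named published facts and ONE
# displayed lower bound (Carayol–Livné at the additive prime)
# (`--supports stmt-BirchSwinnertonDyer-19064` helper; seat bsd-line-er5-p2 = -w3 width seat of the 19064 line)

HONEST FRAMING. Theorems only; no definition, no named fact, no `sorry`; NO route file imported. The file serves the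
registered stub `stub_memberRatEqAtThree` (`∀ W p, ClassX11a W p → p = 3 → ¬ X11a.ShaAnUnit W p →
OddChain.MemberRatEqAt W p`, line `birth` r4, skeleton 7dea4abf63d4) on a SUB-LOCUS and closes nothing class-wide.
Everything is CONDITIONAL on displayed named facts, one of which — Skinner–Urban's member instance
`thm364_rational_weightK_member_of_bdd_ofLevel_ram` — is used AT `p = 3`, where the cell referee's flag
`SU14-12.3.6-mu@nonsplit@3` (ACTIVE-PRINT-GAP) applies, exactly as in the sibling `PrintX11aLowerHalfThreeRamMember`
(p617929). BSD is not proved for any curve or class by this file. beyond-print theorem: no.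

## What

The sibling derives the lower half at an X11a pair with `p = 3` from 22 named facts and the displayed EXISTENCE of a
«ram member» (a good-ordinary member `(g, ι)` of `H(E[3])`, `IsOrdinaryMemberOfLevel W 3 g ι`, whose level `M` has
a prime `q ∥ M`, `q ≠ 3`, `q² ∣ N`). Here that member is CONSTRUCTED at the pairs with a place `v ∣ ℓ` of additive
reduction of Kodaira type `IV`/`IV*` (`3 ∣ #Φ_v(𝔽̄_v)`) and `f_v = 2` (`ℓ³ ∤ N`), for `ρ̄_{E,3}` onto:
* §1 `exists_levelLoweredNewform_exactlyDvd_of_kodaira_three` — the named fact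
  `ribet1990_levelLowering_gamma0_newform_at_three_additiveDrop` (Ribet 1990 ∕ Diamond 1995 ∕ DDT Thm. 3.15 + Lemma
  2.7: optimal level with the exponent drop `f_v ↦ f_v − 1` at the additive places with `3 ∣ #Φ_v`), fed with the
  dropping set `A` and the unramified-multiplicative set `D` CONSTRUCTED from the curve (the bsd-addord cell's
  `exists_dropSet`, `exists_decomposition_exactlyDividing`), gives a weight-two NEWFORM `g` of a level `M₁ ∣ N` with
  `ℓ ∥ M₁`, `9 ∤ M₁`, `a_3(g)` a `3`-adic unit, congruent to `E` at every prime `∤ N` (no (ram) hypothesis needed: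
  ramified multiplicative primes stay in `M₁`);
* §2 `exists_ordinaryMemberOfLevel_six_of_weightTwo` — the tree's Deligne–Serre lift with ALL Hecke operators kept
  (`E₄ ≡ 1 (mod 3)`) and `3`-stabilisation backwards ∕ the newform behind the lift turn `g` into a GOOD-ORDINARY
  WEIGHT-SIX MEMBER `(g', ι')` of `H(E[3])` of some level `M ∣ M₁` prime to `3` (unconditional given `g`);
* §3 `exists_ramMember_three_of_kodaira_of_levelLowerBound` — `ℓ² ∤ M` as `M ∣ M₁`; the one missing inequality
  `ℓ ∣ M` is the DISPLAYED hypothesis `hlow` «every good-ordinary member of `H(E[3])` has level divisible by `ℓ`»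
  (Carayol 1986 ∕ Livné 1989, `N(ρ̄_{E,3}) ∣` level — DDT Thm. 3.1 (d) mod `ℓ`, p. 87 — read at the additive place
  `v`, where `E[3]^{I_v} ↪ Φ_v(𝔽̄_v)[3]` forces `ρ̄_{E,3}` to ramify); printed, displayed verbatim, nowhere asserted
  (a companion file types it and discharges `hlow` by name). Then
  `ClassX11a.missingLowerBoundAt_three_of_kodaira_of_levelLowerBound_of_facts` ∕
  `memberRatEqAt_three_of_kodaira_of_levelLowerBound_of_su`: the lower half `Typed.MissingLowerBoundAt W 3` ∕ the
  stub's conclusion `OddChain.MemberRatEqAt W 3` at every such pair from 24 named facts + `hlow` — NO per-pair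
  certificate, NO unprinted statement. In range (`N < 5·10⁵`, cell census `census/x11a3_kodaira.tsv`): 91 of the 448
  deep X11a classes at `3`, all on the surjective leaf. The per-pair inputs (`Surj W 3`; `v` additive, `3 ∣ #Φ_v`,
  `p_v³ ∤ N`) are decidable by Tate's algorithm.
NOT done: the 357 ∕ 448 deep classes off this sub-locus (incl. all 11 non-surjective), whose members have no level
with an exactly-dividing ramified prime and which no printed rational main-conjecture statement at `p = 3` reaches
(Wan 2015 Thm. 4: `p ≥ 5`; Burungale–Castella–Skinner 2025: `p > 3`, weight two; Yan–Zhu 2026: weight two;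
Fouquet–Wan 2021 preprint: again a Steinberg prime with `ρ̄` ramified).

References: [DarmonDiamondTaylor1995] Thm. 3.15, Lemma 2.7, Thm. 3.1 (d), p. 87; [Diamond1995RefinedSerre] Thm. 6.4,
Cor. 6.5; [Ribet1990] Thm. 1.1; [Carayol1986] Thm. (A); [Livne1989]; [DeligneSerreASENS1974] 6.9–6.11;
[Hida2022EMI] Cor. 4.1.30; [SkinnerUrban2014] Thm. 1 = 3.6.4; [EmertonPollackWeston2006] p. 2, Thm. 5.1.3;
[SilvermanATAEC1994] Cor. IV.9.2, Table 4.1; cell files `pub/bsd-stepL/line-er5-p2/P3-LOWER-AUDIT.md` §4–4b.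
-/

noncomputable section

open scoped Classical MatrixGroups ModularForm
open CongruenceSubgroup UpperHalfPlane WeierstrassCurve IsDedekindDomain Rat.HeightOneSpectrum
open Literature.NumberTheory.EllipticCurves Literature.NumberTheory.EllipticCurves.ModularForms
  Literature.NumberTheory.EllipticCurves.Rank1Residual
  Literature.NumberTheory.EllipticCurves.Rank1Residual.Typed
  Literature.NumberTheory.EllipticCurves.Wuthrich2014
  Literature.NumberTheory.EllipticCurves.SteinWuthrich2013
  Literature.NumberTheory.EllipticCurves.Greenberg1999
  Literature.NumberTheory.EllipticCurves.Kato2004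
  Literature.NumberTheory.EllipticCurves.GreenbergVatsal2000
  Literature.NumberTheory.EllipticCurves.EmertonPollackWeston2006
  Literature.NumberTheory.EllipticCurves.SkinnerUrban2014
  Literature.NumberTheory.GaloisRepresentations
  Literature.NumberTheory.Automorphic
  Summit.BirchSwinnertonDyer.Rank1Residual
  Summit.BirchSwinnertonDyer.Rank1Residual.X1.MuLambda
  Summit.BirchSwinnertonDyer.Rank1Residual.X11a
  Summit.BirchSwinnertonDyer.Rank1Residual.X11a.LambdaNorm
  Summit.BirchSwinnertonDyer.Rank1Residual.X11a.Chain
open Summit.BirchSwinnertonDyer.BirchSwinnertonDyer.Theorems.KimAtThreeDeepLowerOffStratumLevelLoweringMultiStabDepleteRowsClass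
  (exists_dropSet)
open Summit.BirchSwinnertonDyer.BirchSwinnertonDyer.Theorems.KimAtThreeDeepLowerOffStratumLevelLoweringMultiStabRowsRamClass
  (exists_decomposition_exactlyDividing)

-- the summit and its single problem are both named `BirchSwinnertonDyer` (registry layout D-0017)
set_option linter.dupNamespace false
set_option autoImplicit false

namespace Summit.BirchSwinnertonDyer.BirchSwinnertonDyer.Theorems.OddChain

section Norm

variable {p : ℕ} [Fact p.Prime]

/-- `Valued.v x < 1 ↔ ‖x‖ < 1` in `ℚ̄_p`. [folklore] -/
private theorem v_lt_one_iff (x : PadicAlgCl p) : Valued.v x < 1 ↔ ‖x‖ < 1 := by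
  rw [PadicAlgCl.valuation_def, ← NNReal.coe_lt_coe, coe_nnnorm, NNReal.coe_one]

/-- Chaining two congruences modulo `𝔪`. [folklore] -/
private theorem norm_sub_lt_one_trans' {x y z : PadicAlgCl p} (h₁ : ‖x - y‖ < 1) (h₂ : ‖y - z‖ < 1) :
    ‖x - z‖ < 1 := by
  rw [show x - z = (x - y) + (y - z) by ring]
  exact (PadicAlgCl.isNonarchimedean p _ _).trans_lt (max_lt h₁ h₂)

/-- An element congruent to an element of norm `1` has norm `1`. [folklore] -/
private theorem norm_eq_one_of_norm_sub_lt_one' {x y : PadicAlgCl p} (hy : ‖y‖ = 1) (h : ‖x - y‖ < 1) :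
    ‖x‖ = 1 := by
  refine le_antisymm ?_ (not_lt.mp fun hlt ↦ ?_)
  · rw [show x = (x - y) + y by ring]
    exact (PadicAlgCl.isNonarchimedean p _ _).trans (max_le h.le hy.le)
  · have h3 := PadicAlgCl.isNonarchimedean p x (-(x - y))
    rw [norm_neg, ← sub_eq_add_neg, show x - (x - y) = y by ring, hy] at h3
    exact (lt_irrefl _) (h3.trans_lt (max_lt hlt h))

end Norm

section LevelLowered

variable {W : WeierstrassCurve ℚ} [W.IsElliptic] [W.IsGloballyMinimal]

/-- **§1 The level-lowered weight-two newform with `ℓ ∥ M₁` at a Kodaira `IV`/`IV*` place.** For a globally minimal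
elliptic `W/ℚ` with `ρ̄_{E,3}` onto and multiplicative `3`, a place `v ∣ ℓ` of additive reduction with
`3 ∣ #Φ_v(𝔽̄_v)` (type `IV`/`IV*`) and `ℓ³ ∤ N` (`f_v = 2`), a modular parametrisation datum and `ι : ℚ̄₃ ≃ ℂ`:
granted the additive-drop fact `hRk`, a NEWFORM `g ∈ S₂(Γ₀(M₁))` with `M₁ ∣ N`, `ℓ ∥ M₁`, `ℓ² ∣ N`, `ℓ ≠ 3`,
`9 ∤ M₁`, `|ι⁻¹ a_3(g)|₃ = 1` and `|ι⁻¹ a_q(g) − a_q(E)|₃ < 1` for every prime `q ∤ N` (`A` = the additive places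
with `3 ∣ #Φ`, `D` = the multiplicative `r ∥ N` with `3 ∣ ord_r Δ`, `3` included when finite; `M₁ = N/(A·D)`).
[cite: DarmonDiamondTaylor1995, Thm. 3.15, Lemma 2.7 and Remark 2.14] [cite: Diamond1995RefinedSerre, Thm. 6.4 and Cor. 6.5]
[cite: Ribet1990, Thm. 1.1] [cite: SilvermanATAEC1994, Cor. IV.9.2 (d), Table 4.1 and Thm. IV.10.2 (c)] -/
theorem exists_levelLoweredNewform_exactlyDvd_of_kodaira_three
    (hRk : ribet1990_levelLowering_gamma0_newform_at_three_additiveDrop)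
    (hsurj : Surj W 3) (hmult : Mult W 3)
    (v : HeightOneSpectrum ℤ) (hadd : W.HasAdditiveReductionAt v)
    (h3Φ : 3 ∣ (W.kodairaSymbolAt v).componentGroupOrder)
    {N : ℕ} [NeZero N] (hN : N = W.conductorNorm ℤ) (hf2 : ¬ natGenerator v ^ 3 ∣ N)
    (D₀ : ModularParametrizationData W N) (ι : PadicAlgCl 3 ≃+* ℂ) :
    ∃ (M₁ : ℕ) (_ : NeZero M₁) (g : CuspForm (Gamma0 M₁) 2), IsNewform0 g ∧
      M₁ ∣ N ∧ natGenerator v ∣ M₁ ∧ ¬ natGenerator v ^ 2 ∣ M₁ ∧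
      natGenerator v ^ 2 ∣ N ∧ natGenerator v ≠ 3 ∧ ¬ 3 ^ 2 ∣ M₁ ∧
      ‖ι.symm (cuspCoeff g 3)‖ = 1 ∧
      ∀ q : ℕ, q.Prime → ¬ q ∣ N →
        ‖ι.symm (cuspCoeff g q) - ((W.frobeniusTrace q : ℤ) : PadicAlgCl 3)‖ < 1 := by
  haveI : Fact (Nat.Prime 3) := ⟨Nat.prime_three⟩
  have hN0 : N ≠ 0 := NeZero.ne N
  have hf := D₀.isNewformOf
  have hfac3 := W.factorization_conductorNorm_eq_one_of_hasMultiplicativeReductionAtPrime 3 hmult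
  have h9 : ¬ 3 ^ 2 ∣ N := fun h ↦ by
    have := (Nat.prime_three.pow_dvd_iff_le_factorization (hN ▸ hN0)).mp (hN ▸ h); omega
  -- the prime `ℓ` under `v`
  set ℓ : ℕ := natGenerator v with hℓdef
  have hℓ : ℓ.Prime := prime_natGenerator v
  haveI : Fact ℓ.Prime := ⟨hℓ⟩
  have hℓ2N : ℓ ^ 2 ∣ N := hN ▸ (natGenerator_sq_dvd_conductorNorm_iff v W).mpr hadd
  have hℓ3 : ℓ ≠ 3 := fun h ↦ h9 (h ▸ hℓ2N)
  -- §1 the dropping set `A`, `ℓ ∣ A`, `A ∣ N`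
  obtain ⟨A, hAsq, hAadd, hAiff, hAdvd⟩ := exists_dropSet W
  haveI : NeZero A := ⟨Squarefree.ne_zero hAsq⟩
  have hℓA : ℓ ∣ A := (hAiff v hadd).mp h3Φ
  rw [← hN] at hAadd
  obtain ⟨N₂, hN₂⟩ : A ∣ N := hAdvd N fun p hp hpA ↦ (dvd_pow_self p two_ne_zero).trans (hAadd p hp hpA)
  have hN₂0 : N₂ ≠ 0 := fun h ↦ hN0 (by rw [hN₂, h, mul_zero])
  -- every prime of `A` is squared in `N = A N₂` with `A` squarefree: it divides `N₂`
  have hAN₂ : ∀ p : ℕ, p.Prime → p ∣ A → p ∣ N₂ := by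
    rintro p hp ⟨A'', hA''⟩
    have hpA'' : ¬ p ∣ A'' := fun h ↦
      hp.ne_one (Nat.isUnit_iff.mp (hAsq p (by rw [hA'']; exact mul_dvd_mul_left p h)))
    have h2 : p * p ∣ p * (A'' * N₂) := by
      rw [← mul_assoc, ← hA'', ← hN₂, ← pow_two]; exact hAadd p hp ⟨A'', hA''⟩
    exact ((Nat.Prime.coprime_iff_not_dvd hp).mpr hpA'').dvd_of_dvd_mul_left
      (Nat.dvd_of_mul_dvd_mul_left hp.pos h2)
  -- `N₂ = M₁·D`, `D` = the primes `r ∥ N` with `3 ∣ ord_r Δ` (all the unramified multiplicative primes)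
  obtain ⟨M₁, D, hMD, hDsq, hDM₁, hDP, hM₁P⟩ :=
    exists_decomposition_exactlyDividing hN₂0 (fun r ↦ (3 : ℤ) ∣ padicValRat r W.Δ ∧ ¬ r ^ 2 ∣ N)
  haveI : NeZero M₁ := ⟨fun h ↦ hN₂0 (by rw [← hMD, h, zero_mul])⟩
  have hNeq' : M₁ * A * D = N := by rw [hN₂, ← hMD]; ring
  have hM₁N : M₁ ∣ N := ⟨A * D, by rw [← hNeq']; ring⟩
  have hDexact : ∀ p : ℕ, p.Prime → p ∣ D → ¬ p ^ 2 ∣ N := fun p hp hpD ↦ ((hDP p hp hpD).1).2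
  have hAD : Nat.Coprime A D := by
    refine Nat.coprime_of_dvd fun p hp hpA hpD ↦ hDexact p hp hpD (hAadd p hp hpA)
  -- `ℓ ∥ M₁`
  have hℓD : ¬ ℓ ∣ D := fun h ↦ hDexact ℓ hℓ h hℓ2N
  have hℓM₁ : ℓ ∣ M₁ :=
    ((Nat.Prime.coprime_iff_not_dvd hℓ).mpr hℓD).dvd_of_dvd_mul_right (by rw [hMD]; exact hAN₂ ℓ hℓ hℓA)
  have hℓ2M₁ : ¬ ℓ ^ 2 ∣ M₁ := fun h ↦ hf2 (by
    rw [← hNeq', pow_succ]; exact (mul_dvd_mul h hℓA).trans ⟨D, by ring⟩)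
  have h9M₁ : ¬ 3 ^ 2 ∣ M₁ := fun h ↦ h9 (h.trans hM₁N)
  -- the hypotheses of the additive-drop fact
  have hcop : Nat.Coprime D (M₁ * A) := Nat.Coprime.mul_right hDM₁ hAD.symm
  have hDΔ : ∀ r : ℕ, r.Prime → r ∣ D → (3 : ℤ) ∣ padicValRat r W.Δ := fun r hr hrD ↦ (hDP r hr hrD).1.1
  have hM₁Δ' : ∀ p : ℕ, p.Prime → p ∣ M₁ → ¬ p ^ 2 ∣ N → ¬ (3 : ℤ) ∣ padicValRat p W.Δ := by
    intro p hp hpM hp2 h3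
    refine hM₁P p hp hpM (fun hp2' ↦ hp2 ?_) ⟨h3, hp2⟩
    rw [← hNeq', mul_assoc, mul_comm A D, ← mul_assoc, hMD]
    exact hp2'.mul_right A
  have hM₁Δ : ∀ p : ℕ, p.Prime → p ∣ M₁ → ¬ p ^ 2 ∣ N → p ≠ 3 → ¬ (3 : ℤ) ∣ padicValRat p W.Δ :=
    fun p hp hpM hp2 _ ↦ hM₁Δ' p hp hpM hp2
  have h3Δ : 3 ∣ M₁ → ¬ (3 : ℤ) ∣ padicValRat 3 W.Δ := fun h3M ↦ hM₁Δ' 3 Nat.prime_three h3M h9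
  obtain ⟨g, hg, hcp, hrem⟩ := hRk W hsurj (N := N) (M₁ := M₁) (A := A) (D := D) hNeq' hDsq hAsq hcop h9 hN
    hDΔ hM₁Δ h3Δ (fun p hp hpA ↦ hAadd p hp hpA) hAiff D₀ ι
  -- the congruences at the good primes `q ∤ N` (`q ∤ D·A`)
  have hfq : ∀ q : ℕ, q.Prime → ¬ q ∣ N → cuspCoeff D₀.f q = ((W.frobeniusTrace q : ℤ) : ℂ) := by
    intro q hq hqN
    haveI : Fact q.Prime := ⟨hq⟩
    rw [hf.2 q, WeierstrassCurve.LFunction_apply_prime_eq_frobeniusTrace W q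
      (hasGoodReductionAtPrime_of_not_dvd_conductorNorm W (hN ▸ hqN))]
  have hcongr : ∀ q : ℕ, q.Prime → ¬ q ∣ N →
      ‖ι.symm (cuspCoeff g q) - ((W.frobeniusTrace q : ℤ) : PadicAlgCl 3)‖ < 1 := by
    intro q hq hqN
    have hqDA : ¬ q ∣ D * A := fun h ↦ hqN (h.trans ⟨M₁, by rw [← hNeq']; ring⟩)
    have h1 := (v_lt_one_iff _).mp (hcp q hq hqDA)
    rw [map_sub, hfq q hq hqN, map_intCast, ← norm_neg, neg_sub] at h1
    exact h1
  -- `a_3(g)` is a `3`-adic unit: `a_3(f_E) = ±1`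
  have hf3 : cuspCoeff D₀.f 3 = 1 ∨ cuspCoeff D₀.f 3 = -1 := by
    by_cases hs : W.HasSplitMultiplicativeReductionAtPrime 3
    · exact Or.inl (hf.cuspCoeff_eq_one_and_sq_of_split hs).1
    · exact Or.inr (hf.cuspCoeff_eq_neg_one_and_dvd_of_nonsplit hmult hs).1
  have hι3 : ‖ι.symm (cuspCoeff D₀.f 3)‖ = 1 := by
    rcases hf3 with h | h <;> simp [h]
  have hunit : ‖ι.symm (cuspCoeff g 3)‖ = 1 := by
    by_cases h3D : 3 ∣ D
    · -- `3 ∈ D`: `a_3(g) ≡ 4 a_3(f) = ±4`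
      have h1 := (v_lt_one_iff _).mp (hrem 3 Nat.prime_three h3D)
      have h4 : ‖ι.symm (cuspCoeff D₀.f 3 * (3 + 1))‖ = 1 := by
        rw [map_mul, norm_mul, hι3, one_mul, map_add, map_ofNat, map_one]
        have h34 : ((3 : PadicAlgCl 3) + 1) = ((4 : ℕ) : PadicAlgCl 3) := by norm_num
        rw [h34, ← map_natCast (algebraMap ℚ_[3] (PadicAlgCl 3)) 4]
        change ‖(((4 : ℕ) : ℚ_[3]) : PadicAlgCl 3)‖ = 1
        rw [PadicAlgCl.norm_extends, Padic.norm_natCast_eq_one_iff]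
        decide
      rw [map_sub] at h1
      exact norm_eq_one_of_norm_sub_lt_one' h4 h1
    · -- `3 ∉ D`, so `3 ∤ D·A` (`A`'s primes are additive, `9 ∤ N`): `a_3(g) ≡ a_3(f) = ±1`
      have h3A : ¬ 3 ∣ A := fun h ↦ h9 (hAadd 3 Nat.prime_three h)
      have h3DA : ¬ 3 ∣ D * A := fun h ↦ ((Nat.Prime.dvd_mul Nat.prime_three).mp h).elim h3D h3A
      have h1 := (v_lt_one_iff _).mp (hcp 3 Nat.prime_three h3DA)
      rw [map_sub, ← norm_neg, neg_sub] at h1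
      exact norm_eq_one_of_norm_sub_lt_one' hι3 h1
  exact ⟨M₁, inferInstance, g, hg, hM₁N, hℓM₁, hℓ2M₁, hℓ2N, hℓ3, h9M₁, hunit, hcongr⟩

end LevelLowered

section WeightSix

variable {W : WeierstrassCurve ℚ} [W.IsElliptic] [W.IsGloballyMinimal]

/-- **§2 A good-ordinary weight-six member of `H(E[3])` from a congruent weight-two newform.** From a newform
`g ∈ S₂(Γ₀(M₁))`, `M₁ ∣ N`, `9 ∤ M₁`, with `|ι⁻¹ a_3(g)|₃ = 1` and `|ι⁻¹ a_q(g) − a_q(E)|₃ < 1` for every prime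
`q ∤ N`: a newform `g'` of weight `2 + 4` and some level `M ∣ M₁` PRIME TO `3` with `IsOrdinaryMemberOfLevel W 3 g' ι'`.
Proof: the tree's Deligne–Serre lift with ALL Hecke operators kept (`g · E₄`, `E₄ ≡ 1 (mod 3)`); if `3 ∥ M₁` the lift
has a unit `U₃`-eigenvalue and `3`-stabilisation backwards (weight `> 2`) gives the newform of level `M ∣ M₁`, `3 ∤ M`;
if `3 ∤ M₁` the newform behind the lift has `a_3 ≡ a_3(g)` at the good prime `3`. Unconditional.
[cite: DeligneSerreASENS1974, 6.9–6.11] [cite: Hida2022EMI, Cor. 4.1.30 (proof)] [cite: DiamondShurman2005, Thm. 5.8.3]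
[cite: EmertonPollackWeston2006, Intro p. 2 (H(ρ̄): members of every tame level)] -/
theorem exists_ordinaryMemberOfLevel_six_of_weightTwo (ι : PadicAlgCl 3 ≃+* ℂ) {N M₁ : ℕ} [NeZero N] [NeZero M₁]
    (hN : N = W.conductorNorm ℤ) {g : CuspForm (Gamma0 M₁) 2} (hg : IsNewform0 g) (hM₁N : M₁ ∣ N)
    (h9M₁ : ¬ 3 ^ 2 ∣ M₁) (hunit : ‖ι.symm (cuspCoeff g 3)‖ = 1)
    (hcongr : ∀ q : ℕ, q.Prime → ¬ q ∣ N →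
      ‖ι.symm (cuspCoeff g q) - ((W.frobeniusTrace q : ℤ) : PadicAlgCl 3)‖ < 1) :
    ∃ (M : ℕ) (_ : NeZero M) (_ : M ∣ M₁) (_ : ¬ 3 ∣ M) (k : ℤ) (g' : CuspForm (Gamma0 M) k)
      (ι' : coeffField g' →+* PadicAlgCl 3),
      (haveI : Fact (Nat.Prime 3) := ⟨Nat.prime_three⟩; IsOrdinaryMemberOfLevel W 3 g' ι') := by
  haveI : Fact (Nat.Prime 3) := ⟨Nat.prime_three⟩
  have hw3 : 3 ≤ 4 := by norm_num
  have hwe : Even 4 := by decide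
  have hpw : (3 - 1) ∣ 4 := by norm_num
  -- the member embedding attached to a newform `g'` and `ι`
  have member : ∀ {M : ℕ} [NeZero M] (_ : M ∣ M₁) (_ : ¬ 3 ∣ M) (g' : CuspForm (Gamma0 M) ((2 : ℤ) + (4 : ℕ))),
      IsNewform0 g' → ‖ι.symm ((qExpansion 1 ⇑g').coeff 3)‖ = 1 →
      (∀ q : ℕ, q.Prime → ¬ q ∣ M₁ →
        ‖ι.symm ((qExpansion 1 ⇑g').coeff q) - ι.symm (cuspCoeff g q)‖ < 1) →
      ∃ (M' : ℕ) (_ : NeZero M') (_ : M' ∣ M₁) (_ : ¬ 3 ∣ M') (k : ℤ) (g'' : CuspForm (Gamma0 M') k)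
        (ι' : coeffField g'' →+* PadicAlgCl 3), IsOrdinaryMemberOfLevel W 3 g'' ι' := by
    intro M _ hMM₁ h3M g' hg' hord hcq
    let ι' : coeffField g' →+* PadicAlgCl 3 :=
      (ι.symm : ℂ →+* PadicAlgCl 3).comp (algebraMap (coeffField g') ℂ)
    have hι : ∀ (x : ℂ) (hx : x ∈ coeffField g'), ι' ⟨x, hx⟩ = ι.symm x := fun _ _ ↦ rfl
    refine ⟨M, inferInstance, hMM₁, h3M, (2 : ℤ) + (4 : ℕ), g', ι', by norm_num, by norm_num, hg', ?_, ?_⟩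
    · rw [hι]; exact hord
    · intro ℓ hℓ hℓNM
      have hℓN : ¬ ℓ ∣ N := fun h ↦ hℓNM (hN ▸ h.mul_right M)
      have hℓM₁ : ¬ ℓ ∣ M₁ := fun h ↦ hℓN (h.trans hM₁N)
      rw [hι]
      exact norm_sub_lt_one_trans' (hcq ℓ hℓ hℓM₁) (hcongr ℓ hℓ hℓN)
  by_cases h3M₁ : 3 ∣ M₁
  · -- `3 ∥ M₁`: Deligne–Serre lift keeping `U_3`, then `3`-stabilisation backwards (`k = 6 > 2`)
    obtain ⟨F, c, hF0, hTF, hcong⟩ := exists_eigenform0_congr_of_isNewform0 (p := 3) ι le_rfl hg hw3 hwe hpw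
    have hu : ‖ι.symm (c 3)‖ = 1 := norm_eq_one_of_norm_sub_lt_one' hunit (hcong 3 Nat.prime_three)
    obtain ⟨M, _, hMM₁, h3M, g', hg', hga, -, hnorm⟩ :=
      exists_isNewform0_of_ordinary_eigenform_of_exactly_dvd (p := 3) ι h3M₁ h9M₁ (by norm_num) hF0
        (fun q hq _ ↦ hTF q hq) (hTF 3 Nat.prime_three) hu
    refine member hMM₁ h3M g' hg' hnorm fun q hq hqM₁ ↦ ?_
    rw [hga q hq hqM₁]
    exact hcong q hq
  · -- `3 ∤ M₁`: Deligne–Serre lift and the newform behind it; `a_3` is read at a good prime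
    obtain ⟨M, _, hMM₁, g', hg', hcq⟩ := exists_isNewform0_dvd_level_congr (p := 3) ι le_rfl hg hw3 hwe hpw
    have h3M : ¬ 3 ∣ M := fun h ↦ h3M₁ (h.trans hMM₁)
    have hord : ‖ι.symm ((qExpansion 1 ⇑g').coeff 3)‖ = 1 :=
      norm_eq_one_of_norm_sub_lt_one' hunit (hcq 3 Nat.prime_three h3M₁)
    exact member hMM₁ h3M g' hg' hord hcq

end WeightSix

section Pair

variable {W : WeierstrassCurve ℚ} [W.IsElliptic] [W.IsGloballyMinimal] {p : ℕ} [Fact p.Prime]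

/-- **§3 The «ram member» at a pair with `p = 3` on the Kodaira sub-locus, modulo the displayed Carayol–Livné lower
bound.** Multiplicative `3`, `ρ̄_{E,3}` onto, a place `v ∣ ℓ` of additive reduction of type `IV`/`IV*` with `ℓ³ ∤ N`:
granted modularity `hNf`, the additive-drop fact `hRk`, and the DISPLAYED hypothesis `hlow` «every good-ordinary member
of `H(E[3])` has level divisible by `ℓ`» (Carayol 1986 ∕ Livné 1989 at the additive prime `ℓ`; printed, displayed, not
asserted), a good-ordinary member of `H(E[3])` of a level `M` prime to `3` with `ℓ ∥ M`, `ℓ ≠ 3`, `ℓ² ∣ N` exists.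
[cite: DarmonDiamondTaylor1995, Thm. 3.15 and Thm. 3.1 (d), p. 87] [cite: Carayol1986, Thm. (A)] [cite: Livne1989] -/
theorem exists_ramMember_three_of_kodaira_of_levelLowerBound
    (hNf : exists_isNewformOf) (hRk : ribet1990_levelLowering_gamma0_newform_at_three_additiveDrop)
    (hmult : Mult W p) (hp3 : p = 3) (hsurj : Surj W p)
    (v : HeightOneSpectrum ℤ) (hadd : W.HasAdditiveReductionAt v)
    (h3Φ : 3 ∣ (W.kodairaSymbolAt v).componentGroupOrder) (hf2 : ¬ natGenerator v ^ 3 ∣ W.conductorNorm ℤ)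
    (hlow : ∀ (M : ℕ) [NeZero M] (k : ℤ) (g : CuspForm (Gamma0 M) k) (ι : coeffField g →+* PadicAlgCl p),
      IsOrdinaryMemberOfLevel W p g ι → natGenerator v ∣ M) :
    ∃ (M : ℕ) (_ : NeZero M) (_ : ¬ p ∣ M) (k : ℤ) (g : CuspForm (Gamma0 M) k)
      (ι : coeffField g →+* PadicAlgCl p), IsOrdinaryMemberOfLevel W p g ι ∧
      ∃ q : ℕ, q.Prime ∧ q ≠ p ∧ q ∣ M ∧ ¬ q ^ 2 ∣ M ∧ q ^ 2 ∣ W.conductorNorm ℤ := by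
  subst hp3
  haveI : NeZero (W.conductorNorm ℤ) := ⟨(W.conductorNorm_pos_holds).ne'⟩
  obtain ⟨f, hf⟩ := hNf W
  obtain ⟨D₀⟩ := nonempty_modularParametrizationData_of_isNewformOf hf
  obtain ⟨ι⟩ := PadicAlgCl.nonempty_ringEquiv_complex 3
  obtain ⟨M₁, _, g, hg, hM₁N, hℓM₁, hℓ2M₁, hℓ2N, hℓ3, h9M₁, hunit, hcongr⟩ :=
    exists_levelLoweredNewform_exactlyDvd_of_kodaira_three hRk hsurj hmult v hadd h3Φ rfl hf2 D₀ ι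
  obtain ⟨M, _, hMM₁, h3M, k, g', ι', hmem⟩ :=
    exists_ordinaryMemberOfLevel_six_of_weightTwo ι rfl hg hM₁N h9M₁ hunit hcongr
  have hℓM : natGenerator v ∣ M := hlow M k g' ι' hmem
  have hℓ2M : ¬ natGenerator v ^ 2 ∣ M := fun h ↦ hℓ2M₁ (h.trans hMM₁)
  exact ⟨M, inferInstance, h3M, k, g', ι', hmem, natGenerator v, prime_natGenerator v, hℓ3, hℓM, hℓ2M, hℓ2N⟩

/-- **The registered stub's conclusion `OddChain.MemberRatEqAt W p` AT AN X11a PAIR WITH `p = 3` ON THE KODAIRA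
SUB-LOCUS** (`ρ̄_{E,3}` onto, a type `IV`/`IV*` place `v ∣ ℓ` with `ℓ³ ∤ N`), from THREE named facts — modularity,
the additive-drop level lowering, and Skinner–Urban's member instance `hSU` (Thm. 3.6.4 rational, for the constructed
ram member; FLAG `SU14-12.3.6-mu@nonsplit@3` ACTIVE-PRINT-GAP at `p = 3`) — and the displayed Carayol–Livné lower
bound `hlow`. No certificate, no unprinted statement; PER PAIR; CONDITIONAL; closes nothing class-wide.
[cite: SkinnerUrban2014, Thm. 1 (p. 2) = Thm. 3.6.4 (p. 43)] [cite: DarmonDiamondTaylor1995, Thm. 3.15, Thm. 3.1 (d)]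
[cite: EmertonPollackWeston2006, Intro p. 2 (H(ρ̄))] -/
theorem memberRatEqAt_three_of_kodaira_of_levelLowerBound_of_su
    (hNf : exists_isNewformOf) (hRk : ribet1990_levelLowering_gamma0_newform_at_three_additiveDrop)
    (hSU : thm364_rational_weightK_member_of_bdd_ofLevel_ram)
    (hX : ClassX11a W p) (hp3 : p = 3) (hsurj : Surj W p)
    (v : HeightOneSpectrum ℤ) (hadd : W.HasAdditiveReductionAt v)
    (h3Φ : 3 ∣ (W.kodairaSymbolAt v).componentGroupOrder) (hf2 : ¬ natGenerator v ^ 3 ∣ W.conductorNorm ℤ)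
    (hlow : ∀ (M : ℕ) [NeZero M] (k : ℤ) (g : CuspForm (Gamma0 M) k) (ι : coeffField g →+* PadicAlgCl p),
      IsOrdinaryMemberOfLevel W p g ι → natGenerator v ∣ M) :
    MemberRatEqAt W p :=
  memberRatEqAt_of_su_of_ramMember W p hSU hX.ne_two hX.mult hX.irr
    (exists_ramMember_three_of_kodaira_of_levelLowerBound hNf hRk hX.mult hp3 hsurj v hadd h3Φ hf2 hlow)

/-- **AT AN X11a PAIR WITH `p = 3` ON THE KODAIRA SUB-LOCUS: the lower half `Typed.MissingLowerBoundAt W p` from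
24 NAMED PUBLISHED FACTS and the displayed Carayol–Livné lower bound `hlow`, NOTHING ELSE** — the sibling's door
`ClassX11a.missingLowerBoundAt_three_of_ramMember_of_facts` (p617929: 22 facts incl. S–U's flagged member instance;
the certificate `μ^an(E,3) = 0` is x11a line p2's theorem) with its ram-member hypothesis DISCHARGED by §3. Inputs per
pair: `ClassX11a W 3`, `Surj W 3`, a place `v` of additive reduction with `3 ∣ #Φ_v(𝔽̄_v)` and `p_v³ ∤ N` (decidable
by Tate's algorithm). PER PAIR; CONDITIONAL on the facts (one flagged) and on `hlow`; closes nothing class-wide.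
[cite: SkinnerUrban2014, Thm. 1 (p. 2) = Thm. 3.6.4 (p. 43)] [cite: Mazur1978, Cor. 4.1]
[cite: DarmonDiamondTaylor1995, Thm. 3.15, Thm. 3.1 (d)] [cite: EmertonPollackWeston2006, Thm. 5.1.3] -/
theorem _root_.Summit.BirchSwinnertonDyer.Rank1Residual.ClassX11a.missingLowerBoundAt_three_of_kodaira_of_levelLowerBound_of_facts
    (hNf : exists_isNewformOf)
    (h311 : thm311_cotorsion_weightK_member_ofLevel_odd) (hT1a : thm1_muAlg_of_weightK_member_ofLevel_odd)
    (hT1b : thm513_transfer_from_weightK_member_of_bdd_ofLevel_odd)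
    (h61 : DeligneSerre1974.thm61_exists_adicGaloisRep) (h326 : Hida2000_thm326_ordinary)
    (hKato : kato_charIdeal_dvd_multiplicative_of_surjective)
    (h20 : lemma20_surjective_threeAdic_of_semistable)
    (h12 : Kato2004.thm12_4)
    (hns : Kato2004.exists_multDivisibilityInputs_nonsplit)
    (hsp : Kato2004.exists_multDivisibilityInputs_split)
    (h15 : thm15_isTorsion_multiplicative_rat)
    (h18 : Wuthrich2014.corollary18_padicLFunction_mem_iwasawaAlgebra_multiplicative)
    (hfine : Kato2004.exists_multDivisibilityInputs_fine)
    (hJs : thm61_splitMultiplicative) (hJn : thm61_nonsplitMultiplicative)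
    (hGZK : rank_eq_analyticRank_of_analyticRank_le_one)
    (hGS : greenberg_stevens (W := W) (p := p))
    (hMz : mazur_not_dvd_maninConstant_of_odd)
    (hSU : thm364_rational_weightK_member_of_bdd_ofLevel_ram)
    (hRk : ribet1990_levelLowering_gamma0_newform_at_three_additiveDrop)
    (hX : ClassX11a W p) (hp3 : p = 3) (hsurj : Surj W p)
    (v : HeightOneSpectrum ℤ) (hadd : W.HasAdditiveReductionAt v)
    (h3Φ : 3 ∣ (W.kodairaSymbolAt v).componentGroupOrder) (hf2 : ¬ natGenerator v ^ 3 ∣ W.conductorNorm ℤ)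
    (hlow : ∀ (M : ℕ) [NeZero M] (k : ℤ) (g : CuspForm (Gamma0 M) k) (ι : coeffField g →+* PadicAlgCl p),
      IsOrdinaryMemberOfLevel W p g ι → natGenerator v ∣ M) :
    MissingLowerBoundAt W p :=
  hX.missingLowerBoundAt_three_of_ramMember_of_facts hNf h311 hT1a hT1b h61 h326 hKato h20 h12 hns hsp h15 h18 hfine
    hJs hJn hGZK hGS hMz hSU hp3
    (exists_ramMember_three_of_kodaira_of_levelLowerBound hNf hRk hX.mult hp3 hsurj v hadd h3Φ hf2 hlow)

end Pair

end Summit.BirchSwinnertonDyer.BirchSwinnertonDyer.Theorems.OddChain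

end
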